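import Mathlib
import Summits.NavierStokesRegularity.NavierStokesRegularity.Theorems.EulerZoomLiouvillePowerGaugeEulerLiouvilleKelvinPhysical
import Summits.NavierStokesRegularity.NavierStokesRegularity.Theorems.EulerZoomLiouvillePowerGaugeEulerLiouvilleSwirlfreeLedgerFlow
import Literature.Analysis.FluidPDE.VorticityTransportFormulaProofs
import Literature.Analysis.FluidPDE.ParticleTrajectoryFlow
import Literature.Analysis.FluidPDE.ClassicalSolution
import Literature.Analysis.FluidPDE.VorticityCalculus
import HarnessLib

/-!
# Crux `EulerZoomLiouville.PowerGaugeEulerLiouville` (stmt-NavierStokesRegularity-19832), line `stretching-budget`, stub K1: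
# FLOOR TRANSPORT — a sub-threshold stretching budget carries vorticity floor blobs backward along the particle flow

Route №10 `EulerZoomLiouville` (NavierStokesRegularity), crux E.  Line `stretching-budget` (ideator ns-idea-11 g4;
`Cruxes/PowerGaugeEulerLiouville/Lines/stretching_budget.lean`, card `Lines/stretching-budget.md`, idea-crit V33 PASS-WITH-PRICE),
stub `stub_floorTransport` (K1), proved here with its signature `Sig.stub_floorTransport` UNFOLDED in the tree's vocabulary (the line's
`IsDriftingPastWith`, `HasStretchingBudget`, `FloorBlobsPersist`, `driftRadius` are `def`s of the Cruxes file, which a Theorems file cannot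
import; the statement below is their `δ`-unfolding, so the skeleton fills the stub by
`theorem stub_floorTransport : Sig.stub_floorTransport := floorBlobsPersist_of_driftingPast` — glue `example` checked rc 0).

THE STATEMENT.  Let `(u, p)` be a classical Euler solution on `(−∞,0) × ℝ³` with a DRIFTING FAR PAST `(T₁, M, κ)` (`T₁ ≤ 0`,
`0 ≤ M`, `κ < 1`, `‖u(τ,x)‖ ≤ M(−τ)^{−κ}` for `τ < T₁`, and the gradient bounded on every compact time interval of `(−∞,0)`
uniformly in `x`) and a STRETCHING BUDGET `(K, Λ)` on `(−∞,T₁)` (`K ≥ 0`, `Λ ≥ 0` integrable,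
`⟪∇u(τ,x) ω, ω⟫ ≤ (K/(−τ) + Λ(τ))|ω|²`, `ω = curl u(τ,x)`).  Then FLOOR BLOBS PERSIST: for `t₁ < t₀ < T₁` and a late blob `B(x₀,δ)` on
which `|curl u(t₀)| ≥ w ≥ 0` there is a measurable `T ⊆ B(0, ‖x₀‖ + δ + D)`, `D = M((−t₁)^{1−κ} − (−t₀)^{1−κ})/(1−κ)` (the line's
`driftRadius M κ t₀ t₁`), of the SAME volume as the blob, on which `|curl u(t₁)|² ≥ w² e^{−2∫_{(t₁,t₀)}Λ} ((−t₀)/(−t₁))^{2K}`.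

THE PROOF (Majda–Bertozzi §1.3/§1.6, Lagrangian).  On the open convex time set `S = (t₁ − 1, t₀/2) ⊂ (−∞,0)` the compact-time gradient
bound gives the Cauchy–Lipschitz hypotheses `ODE.IsUniformlyLipschitzOn u S` (`isUniformlyLipschitzOn_of_norm_fderiv_le'`), so the TRUE
particle flow `X = ODE.evolutionMap u t₀` is global (no cut-off is needed, unlike the sibling line `casimir-floor`): `T := X_{t₁}(B(x₀,δ))`.
(i) CONFINEMENT `‖X_{t₁} a − a‖ ≤ D` from the velocity envelope (`SwirlfreeLedger.norm_evolutionMap_sub_le`); (ii) VOLUME `vol T = vol B`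
(`KelvinPhysical.volume_image_evolutionMap`, `det DX = 1`); (iii) MEASURABILITY by Lusin–Souslin (continuous injective image of a ball);
(iv) FLOOR: along the path of `a ∈ B(x₀,δ)`, `G(s) = |ω(s, X_s a)|²` has `G' = 2⟪ω, ∇u ω⟫` (the inviscid vorticity equation along
trajectories, `IsClassicalNSSolutionOn.hasDerivWithinAt_curl_flow`); first `G' ≤ 2L⁺G` (`‖∇u‖ ≤ L` on `S`) keeps `G > 0` on `[t₁,t₀]`
backward from `G(t₀) ≥ w² > 0`; then `ψ(s) = log G(s) + 2K log(−s)` has `ψ' = G'/G − 2K/(−s) ≤ 2Λ(s)` on `(t₁,t₀)` by the budget, and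
the FTC inequality for an integrable majorant (`intervalIntegral.sub_le_integral_of_hasDeriv_right_of_le`) gives
`ψ(t₀) − ψ(t₁) ≤ 2∫_{(t₁,t₀)}Λ`, i.e. `G(t₁) ≥ G(t₀) e^{−2∫Λ} ((−t₀)/(−t₁))^{2K}`.  (`w = 0`: the floor is trivial.)

* `floor_of_log_ineq` — real-variable unpacking of the log-inequality;
* **`floorBlobsPersist_of_driftingPast`** — the stub signature, unfolded.

WHAT THIS IS NOT: not NS, not the crux — a helper `--supports` stmt-19832 on the line `stretching-budget`: K1 of the STRATUM THEOREM
«drifting classical far past + sub-threshold positive stretching budget ⇒ trivial» about a hypothetical Euler zoom-limit class (K2 =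
`StretchingBudget.pastCurlFree_of_floorBlobsPersist`, landed; the residue K3 `stub_budgetRest` stays OPEN); crux 19832, rung N0 and NS
regularity stay OPEN; no summit statement is proved here.
[cite: MajdaBertozziCUP2002, §1.6 (1.50)–(1.51), §1.3 Prop. 1.4, §2.5 (2.115)–(2.117); Chae2010, Thm 1.1 (proof display)]
-/

noncomputable section

-- flat `Theorems/<Route><Decl>…` files of one crux share the namespace of the crux (tree convention)
set_option linter.dupNamespace false

open MeasureTheory Set Filter Topology Metric Function InnerProductSpace
open scoped NNReal ENNReal RealInnerProductSpace ContDiff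

namespace Summit.NavierStokesRegularity.NavierStokesRegularity.Theorems.PowerGaugeEulerLiouville.StretchingBudget

open Literature.Analysis Literature.Analysis.FluidPDE
open Summit.NavierStokesRegularity.NavierStokesRegularity.Theorems.PowerGaugeEulerLiouville.SwirlfreeLedger
open Summit.NavierStokesRegularity.NavierStokesRegularity.Theorems.PowerGaugeEulerLiouville.KelvinPhysical

/-! ### Real-variable unpacking (kept out of the main proof) -/

/-- From `log G₀ + 2K log n₀ − (log G₁ + 2K log n₁) ≤ 2I` with `G₀, G₁, n₀, n₁ > 0` and `w² ≤ G₀`: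
`w² e^{−2I} (n₀/n₁)^{2K} ≤ G₁`. [folklore] -/
theorem floor_of_log_ineq {G₀ G₁ w n₀ n₁ K I : ℝ} (hG₀ : 0 < G₀) (hG₁ : 0 < G₁) (hn₀ : 0 < n₀) (hn₁ : 0 < n₁)
    (hw : w ^ 2 ≤ G₀) (h : Real.log G₀ + 2 * K * Real.log n₀ - (Real.log G₁ + 2 * K * Real.log n₁) ≤ 2 * I) :
    w ^ 2 * Real.exp (-(2 * I)) * (n₀ / n₁) ^ (2 * K) ≤ G₁ := by
  have hr : 0 < (n₀ / n₁) ^ (2 * K) := Real.rpow_pos_of_pos (div_pos hn₀ hn₁) _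
  have hkey : G₀ * Real.exp (-(2 * I)) * (n₀ / n₁) ^ (2 * K) ≤ G₁ := by
    rw [← Real.log_le_log_iff (by positivity) hG₁, Real.log_mul (by positivity) hr.ne', Real.log_mul hG₀.ne' (Real.exp_pos _).ne',
      Real.log_exp, Real.log_rpow (div_pos hn₀ hn₁), Real.log_div hn₀.ne' hn₁.ne']
    nlinarith
  have hfac : 0 ≤ Real.exp (-(2 * I)) * (n₀ / n₁) ^ (2 * K) := by positivity
  calc w ^ 2 * Real.exp (-(2 * I)) * (n₀ / n₁) ^ (2 * K) = w ^ 2 * (Real.exp (-(2 * I)) * (n₀ / n₁) ^ (2 * K)) := by ring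
    _ ≤ G₀ * (Real.exp (-(2 * I)) * (n₀ / n₁) ^ (2 * K)) := mul_le_mul_of_nonneg_right hw hfac
    _ = G₀ * Real.exp (-(2 * I)) * (n₀ / n₁) ^ (2 * K) := by ring
    _ ≤ G₁ := hkey

/-! ### The stub, unfolded -/

/-- **K1 `stub_floorTransport` of the line `stretching-budget`, signature unfolded** (`∀ u p T₁ M κ K Λ, IsDriftingPastWith u p T₁ M κ →
0 ≤ K → HasStretchingBudget u T₁ K Λ → FloorBlobsPersist u T₁ M κ K Λ`, with the line's definitions `δ`-unfolded): on a drifting classical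
far past with a stretching budget `(K, Λ)`, `K ≥ 0`, every late vorticity floor blob has at each earlier time a measurable avatar of the same
volume inside `B(0, ‖x₀‖ + δ + driftRadius)` carrying the Grönwall-discounted floor (`T` = backward flow image; proof in the module docstring).
[cite: MajdaBertozziCUP2002, §1.6 (1.50)–(1.51), §1.3 Prop. 1.4, §2.5 (2.115)–(2.117)] -/
theorem floorBlobsPersist_of_driftingPast :
    ∀ (u : ℝ → EuclideanSpace ℝ (Fin 3) → EuclideanSpace ℝ (Fin 3)) (p : ℝ → EuclideanSpace ℝ (Fin 3) → ℝ) (T₁ M κ K : ℝ)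
      (Λ : ℝ → ℝ),
      (IsClassicalEulerSolutionOn (Set.Iio 0) 0 u p ∧ T₁ ≤ 0 ∧ 0 ≤ M ∧ κ < 1 ∧
          (∀ τ : ℝ, τ < T₁ → ∀ x : EuclideanSpace ℝ (Fin 3), ‖u τ x‖ ≤ M * (-τ) ^ (-κ)) ∧
          (∀ t₁ t₂ : ℝ, t₁ < t₂ → t₂ < 0 → ∃ L : ℝ, ∀ τ ∈ Set.Icc t₁ t₂, ∀ x : EuclideanSpace ℝ (Fin 3),
            ‖fderiv ℝ (u τ) x‖ ≤ L)) →
        0 ≤ K →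
          (IntegrableOn Λ (Set.Iio T₁) ∧ (∀ τ : ℝ, 0 ≤ Λ τ) ∧
              ∀ τ : ℝ, τ < T₁ → ∀ x : EuclideanSpace ℝ (Fin 3),
                ⟪fderiv ℝ (u τ) x (curl (u τ) x), curl (u τ) x⟫ ≤ (K / (-τ) + Λ τ) * ‖curl (u τ) x‖ ^ 2) →
            ∀ t₀ : ℝ, t₀ < T₁ → ∀ (x₀ : EuclideanSpace ℝ (Fin 3)) (δ w : ℝ), 0 < δ → 0 ≤ w →
              (∀ x ∈ ball x₀ δ, w ≤ ‖curl (u t₀) x‖) →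
                ∀ t₁ : ℝ, t₁ < t₀ →
                  ∃ T : Set (EuclideanSpace ℝ (Fin 3)), MeasurableSet T ∧
                    T ⊆ ball (0 : EuclideanSpace ℝ (Fin 3))
                      (‖x₀‖ + δ + M / (1 - κ) * ((-t₁) ^ (1 - κ) - (-t₀) ^ (1 - κ))) ∧
                    volume T = volume (ball x₀ δ) ∧
                    ∀ x ∈ T,
                      w ^ 2 * Real.exp (-(2 * ∫ s in Set.Ioo t₁ t₀, Λ s)) * ((-t₀) / (-t₁)) ^ (2 * K) ≤
                        ‖curl (u t₁) x‖ ^ 2 := by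
  intro u p T₁ M κ K Λ hD hK0 hB t₀ ht₀T x₀ δ w hδ hw hball t₁ ht₁
  obtain ⟨hcl, hT₁, hM0, hκ1, henv, hgrad⟩ := hD
  obtain ⟨hΛi, hΛ0, hstretch⟩ := hB
  have ht₀ : t₀ < 0 := lt_of_lt_of_le ht₀T hT₁
  have ht₁0 : t₁ < 0 := ht₁.trans ht₀
  have hnt₀ : 0 < -t₀ := by linarith
  have hnt₁ : 0 < -t₁ := by linarith
  -- the drift radius `D ≥ 0`
  set D : ℝ := M / (1 - κ) * ((-t₁) ^ (1 - κ) - (-t₀) ^ (1 - κ)) with hDdef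
  have h1κ : 0 < 1 - κ := by linarith
  have hMκ : 0 ≤ M / (1 - κ) := div_nonneg hM0 h1κ.le
  have hmono : ∀ s ∈ Icc t₁ t₀, M / (1 - κ) * ((-s) ^ (1 - κ) - (-t₀) ^ (1 - κ)) ≤ D := by
    intro s hs
    rw [hDdef]
    refine mul_le_mul_of_nonneg_left ?_ hMκ
    have h : (-s) ^ (1 - κ) ≤ (-t₁) ^ (1 - κ) :=
      Real.rpow_le_rpow (by linarith [hs.2]) (by linarith [hs.1]) h1κ.le
    linarith
  -- the times
  set S : Set ℝ := Set.Ioo (t₁ - 1) (t₀ / 2) with hS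
  have hSo : IsOpen S := isOpen_Ioo
  have hSc : Convex ℝ S := convex_Ioo _ _
  have hU : UniqueDiffOn ℝ S := hSo.uniqueDiffOn
  have ht₀S : t₀ ∈ S := ⟨by linarith, by linarith⟩
  have ht₁S : t₁ ∈ S := ⟨by linarith, by linarith⟩
  have hSneg : S ⊆ Set.Iio 0 := fun s hs => lt_trans hs.2 (by linarith)
  have hIccS : Icc t₁ t₀ ⊆ S := hSc.ordConnected.out ht₁S ht₀S
  have hclS : IsClassicalEulerSolutionOn S 0 u p := hcl.mono hSneg hU
  -- the Cauchy–Lipschitz hypotheses from the compact-time gradient bound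
  obtain ⟨L, hL'⟩ := hgrad (t₁ - 1) (t₀ / 2) (by linarith) (by linarith)
  have hLS : ∀ t ∈ S, ∀ x : EuclideanSpace ℝ (Fin 3), ‖fderiv ℝ (u t) x‖ ≤ L := fun t ht x =>
    hL' t (Ioo_subset_Icc_self ht) x
  have hL : ODE.IsUniformlyLipschitzOn u S := hclS.smooth_velocity.isUniformlyLipschitzOn_of_norm_fderiv_le' hLS
  -- the particle flow from `t₀`
  set X : ℝ → EuclideanSpace ℝ (Fin 3) → EuclideanSpace ℝ (Fin 3) := ODE.evolutionMap u t₀ with hX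
  have hXu : ∀ t ∈ S, ∀ y, HasDerivWithinAt (fun s => X s y) (u t (X t y)) S t := fun t ht y =>
    hL.hasDerivWithinAt_evolutionMap hSc ht₀S ht y
  have hX0 : ∀ y, X t₀ y = y := fun y => ODE.evolutionMap_self u t₀ y
  -- confinement of the parcels of `B(x₀, δ)`
  have hspeed : ∀ s ∈ Icc t₁ t₀, ∀ y, ‖u s y‖ ≤ M * (-s) ^ (-κ) := fun s hs y =>
    henv s (lt_of_le_of_lt hs.2 ht₀T) y
  have hconf : ∀ a ∈ ball x₀ δ, ‖X t₁ a‖ < ‖x₀‖ + δ + D := by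
    intro a ha
    have hd := norm_evolutionMap_sub_le hL hSc hSo ht₁S ht₀S ht₀ hκ1 hspeed a (left_mem_Icc.2 ht₁.le)
    have han : ‖a‖ < ‖x₀‖ + δ := by
      have h1 : ‖a - x₀‖ < δ := mem_ball_iff_norm.1 ha
      linarith [norm_le_norm_add_norm_sub' a x₀]
    calc ‖X t₁ a‖ ≤ ‖a‖ + ‖X t₁ a - a‖ := norm_le_norm_add_norm_sub' _ _
      _ < ‖x₀‖ + δ + D := add_lt_add_of_lt_of_le han (hd.trans (hmono t₁ (left_mem_Icc.2 ht₁.le)))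
  -- the avatar `T = X_{t₁}(B(x₀, δ))`
  have hcont : Continuous (X t₁) := (hL.contDiff_evolutionMap hSc hU le_top hclS.smooth_velocity ht₀S ht₁S).continuous
  have hinj : InjOn (X t₁) (ball x₀ δ) := (hL.bijective_evolutionMap hSc ht₀S ht₁S).injective.injOn
  refine ⟨X t₁ '' ball x₀ δ, measurableSet_ball.image_of_continuousOn_injOn hcont.continuousOn hinj, ?_, ?_, ?_⟩
  · rintro _ ⟨a, ha, rfl⟩
    exact mem_ball_zero_iff.2 (hconf a ha)
  · exact volume_image_evolutionMap hclS hL hSc hU ht₀S ht₁S measurableSet_ball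
  -- the floor along the path of `a ∈ B(x₀, δ)`
  rintro _ ⟨a, ha, rfl⟩
  by_cases hw0 : w = 0
  · rw [hw0, sq, zero_mul, zero_mul, zero_mul]
    positivity
  have hwpos : 0 < w := lt_of_le_of_ne hw fun h => hw0 h.symm
  -- `G(s) = |ω(s, X_s a)|²` and its derivative along the trajectory
  set G : ℝ → ℝ := fun s => ‖curl (u s) (X s a)‖ ^ 2 with hGdef
  have hG' : ∀ t ∈ S, HasDerivAt G (2 * ⟪curl (u t) (X t a), fderiv ℝ (u t) (X t a) (curl (u t) (X t a))⟫) t := by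
    intro t ht
    have h1 := (hclS.hasDerivWithinAt_curl_flow hU hXu ht a).norm_sq
    exact h1.hasDerivAt (hSo.mem_nhds ht)
  have hGt₀ : w ^ 2 ≤ G t₀ := by
    have h := hball a ha
    simp only [hGdef, hX0]
    exact pow_le_pow_left₀ hw h 2
  have hGt₀pos : 0 < G t₀ := lt_of_lt_of_le (pow_pos hwpos 2) hGt₀
  -- `G' ≤ 2 L⁺ G`: `G` stays positive backward on `[t₁, t₀]`
  set Lp : ℝ := max L 0 with hLp
  have hLp0 : 0 ≤ Lp := le_max_right _ _
  have hG'le : ∀ t ∈ S, 2 * ⟪curl (u t) (X t a), fderiv ℝ (u t) (X t a) (curl (u t) (X t a))⟫ ≤ 2 * Lp * G t := by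
    intro t ht
    set ωv := curl (u t) (X t a) with hω
    have h1 : ⟪ωv, fderiv ℝ (u t) (X t a) ωv⟫ ≤ ‖ωv‖ * ‖fderiv ℝ (u t) (X t a) ωv‖ := real_inner_le_norm _ _
    have h2 : ‖fderiv ℝ (u t) (X t a) ωv‖ ≤ Lp * ‖ωv‖ :=
      (ContinuousLinearMap.le_opNorm _ _).trans (mul_le_mul_of_nonneg_right ((hLS t ht _).trans (le_max_left _ _)) (norm_nonneg _))
    have hG : G t = ‖ωv‖ ^ 2 := by simp only [hGdef, hω]
    rw [hG]
    nlinarith [norm_nonneg ωv, mul_le_mul_of_nonneg_left h2 (norm_nonneg ωv)]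
  set Φ : ℝ → ℝ := fun s => Real.exp (-(2 * Lp * s)) * G s with hΦdef
  have hΦ' : ∀ t ∈ S, HasDerivAt Φ (Real.exp (-(2 * Lp * t)) * (-(2 * Lp)) * G t +
      Real.exp (-(2 * Lp * t)) * (2 * ⟪curl (u t) (X t a), fderiv ℝ (u t) (X t a) (curl (u t) (X t a))⟫)) t := by
    intro t ht
    have he : HasDerivAt (fun s : ℝ => Real.exp (-(2 * Lp * s))) (Real.exp (-(2 * Lp * t)) * (-(2 * Lp))) t := by
      have h1 : HasDerivAt (fun s : ℝ => -(2 * Lp * s)) (-(2 * Lp)) t := by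
        have h := ((hasDerivAt_id t).const_mul (2 * Lp)).neg
        simp only [id, mul_one] at h
        exact h
      exact h1.exp
    exact he.mul (hG' t ht)
  have hΦanti : AntitoneOn Φ (Icc t₁ t₀) := by
    refine antitoneOn_of_hasDerivWithinAt_nonpos (convex_Icc t₁ t₀)
      (fun t ht => (hΦ' t (hIccS ht)).continuousAt.continuousWithinAt)
      (fun t ht => (hΦ' t (hIccS (interior_subset ht))).hasDerivWithinAt) fun t ht => ?_
    have htS : t ∈ S := hIccS (interior_subset ht)
    have he0 : 0 < Real.exp (-(2 * Lp * t)) := Real.exp_pos _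
    have h := mul_le_mul_of_nonneg_left (hG'le t htS) he0.le
    nlinarith
  have hGpos : ∀ s ∈ Icc t₁ t₀, 0 < G s := by
    intro s hs
    have h := hΦanti hs (right_mem_Icc.2 ht₁.le) hs.2
    have h0 : 0 < Real.exp (-(2 * Lp * t₀)) * G t₀ := mul_pos (Real.exp_pos _) hGt₀pos
    exact (mul_pos_iff_of_pos_left (Real.exp_pos _)).1 (lt_of_lt_of_le h0 h)
  -- `ψ(s) = log G(s) + 2K log(−s)` has `ψ' ≤ 2Λ` on `(t₁, t₀)`
  set ψ : ℝ → ℝ := fun s => Real.log (G s) + 2 * K * Real.log (-s) with hψdef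
  have hψ' : ∀ s ∈ Icc t₁ t₀, HasDerivAt ψ
      ((G s)⁻¹ * (2 * ⟪curl (u s) (X s a), fderiv ℝ (u s) (X s a) (curl (u s) (X s a))⟫) +
        2 * K * ((-s)⁻¹ * (-1))) s := by
    intro s hs
    have hsS : s ∈ S := hIccS hs
    have hs0 : -s ≠ 0 := by have : s < 0 := lt_of_le_of_lt hs.2 ht₀; linarith
    have h1 : HasDerivAt (fun r => Real.log (G r))
        ((G s)⁻¹ * (2 * ⟪curl (u s) (X s a), fderiv ℝ (u s) (X s a) (curl (u s) (X s a))⟫)) s :=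
      (Real.hasDerivAt_log (hGpos s hs).ne').comp s (hG' s hsS)
    have h2 : HasDerivAt (fun r : ℝ => Real.log (-r)) ((-s)⁻¹ * (-1)) s :=
      (Real.hasDerivAt_log hs0).comp s (hasDerivAt_neg s)
    exact h1.add (h2.const_mul (2 * K))
  have hψle : ∀ s ∈ Ioo t₁ t₀,
      (G s)⁻¹ * (2 * ⟪curl (u s) (X s a), fderiv ℝ (u s) (X s a) (curl (u s) (X s a))⟫) +
        2 * K * ((-s)⁻¹ * (-1)) ≤ 2 * Λ s := by
    intro s hs
    have hsT : s < T₁ := hs.2.trans ht₀T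
    have hns : 0 < -s := by linarith [hs.2]
    have hGs := hGpos s (Ioo_subset_Icc_self hs)
    set ωv := curl (u s) (X s a) with hω
    have hst : ⟪ωv, fderiv ℝ (u s) (X s a) ωv⟫ ≤ (K / (-s) + Λ s) * ‖ωv‖ ^ 2 := by
      rw [real_inner_comm]; exact hstretch s hsT (X s a)
    have hG : G s = ‖ωv‖ ^ 2 := by simp only [hGdef, hω]
    have h1 : (G s)⁻¹ * (2 * ⟪ωv, fderiv ℝ (u s) (X s a) ωv⟫) ≤ 2 * (K / (-s) + Λ s) := by
      have h2 : (G s)⁻¹ * (2 * ⟪ωv, fderiv ℝ (u s) (X s a) ωv⟫) ≤ (G s)⁻¹ * (2 * ((K / (-s) + Λ s) * ‖ωv‖ ^ 2)) :=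
        mul_le_mul_of_nonneg_left (by linarith) (inv_nonneg.2 hGs.le)
      have h3 : (G s)⁻¹ * (2 * ((K / (-s) + Λ s) * ‖ωv‖ ^ 2)) = 2 * (K / (-s) + Λ s) := by
        rw [← hG]; field_simp
      linarith
    have h4 : 2 * K * ((-s)⁻¹ * (-1)) = -(2 * (K / (-s))) := by rw [div_eq_mul_inv]; ring
    linarith [h1, h4]
  -- the FTC inequality with the integrable majorant `2Λ`
  have hψcont : ContinuousOn ψ (Icc t₁ t₀) := fun s hs => (hψ' s hs).continuousAt.continuousWithinAt
  have hΛint : IntegrableOn (fun s => 2 * Λ s) (Icc t₁ t₀) := by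
    have hsub : Icc t₁ t₀ ⊆ Set.Iio T₁ := fun s hs => lt_of_le_of_lt hs.2 ht₀T
    exact (hΛi.mono_set hsub).integrable.const_mul 2
  have hFTC := intervalIntegral.sub_le_integral_of_hasDeriv_right_of_le ht₁.le hψcont
    (fun s hs => (hψ' s (Ioo_subset_Icc_self hs)).hasDerivWithinAt) hΛint hψle
  have hI : ∫ y in t₁..t₀, 2 * Λ y = 2 * ∫ s in Set.Ioo t₁ t₀, Λ s := by
    rw [intervalIntegral.integral_const_mul, intervalIntegral.integral_of_le ht₁.le, integral_Ioc_eq_integral_Ioo]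
  rw [hI] at hFTC
  -- unpack
  have hψt₀ : ψ t₀ = Real.log (G t₀) + 2 * K * Real.log (-t₀) := rfl
  have hψt₁ : ψ t₁ = Real.log (G t₁) + 2 * K * Real.log (-t₁) := rfl
  rw [hψt₀, hψt₁] at hFTC
  exact floor_of_log_ineq hGt₀pos (hGpos t₁ (left_mem_Icc.2 ht₁.le)) hnt₀ hnt₁ hGt₀ hFTC

end Summit.NavierStokesRegularity.NavierStokesRegularity.Theorems.PowerGaugeEulerLiouville.StretchingBudget

end
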